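import Summits.AtomisticToContinuum.Crystallization.Theorems.FrustratedLawDichotomyStrainedPatchChartFamiliesPinned

/-!
# (F1ʳ-bent₀) decomposed — levels 0 and 1: the LAW-CAPPED refit envelope and the refit bridge (lens-5 g53 «EnvelopeLaw»)

Piece `stmt-AtomisticToContinuum-27623` (`StrainedPatchRec`, T-side), target of record [CORE-FAR] `CoreOffTubeFloor (63/10) (63/10) (24/5) (1/100) 0`,
residual of record [SOFT-FAR] `SoftFarFloor (63/10) (63/10) (24/5) (1/100) (1/10) 0`, bridge [BRIDGE] `BandFarFloor … (3/50) (1/10) 0`.  The critic (row 912)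
asked for the decomposition of **(F1-bent₀)** `FamilyEnvelopeBent0 := FamilyEnvelopeRefit (bentFamily 𝓑₀ (1/16)) (bentFamily 𝓑₀ (7/100)) (1/4) (1/4) Φ₀`.

## Level 0 — the free weakening (finite range in `t`)

(F1ʳ) quantifies over every fine deviation `t ≥ 0`, but the seam `edgeFar_of_familyRefit` only ever feeds it the chart produced by (F2) AT the law's
value `t = T(z₀)`.  **(F1ʳ-cap) `FamilyEnvelopeRefitCap 𝓘₀ 𝓘₁ τ κN Φ T`** := (F1ʳ) with the extra hypothesis `t ≤ T M₀ z₀ c₀`; (F1ʳ) ⟹ (F1ʳ-cap) for every law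
(`familyEnvelopeRefitCap_of_refit`), and the refit seam / node re-prove verbatim (`edgeFar_of_familyRefitCap`, `coreOff_of_familyRefitCap_of_band_of_soft`).
For the law of record `T₀ = windowRoom + (3/10)σ₁`: `T₀ ≤ 1/24` everywhere (`T0_le`) and `T₀ ≤ 1/60` on every chart family `bentFamily 𝓑 η₃`, `η₃ ≤ 1/16`
(`lawLE_T0_bent`, via `fitLevel_le_of_goodAtScale`) — the analytic pieces therefore live on the FINITE RANGE `t ∈ [0, 1/60]`, where the second-order
expansion of the score is available («EnvelopeTaylor»), never in the large-`t` regime that (F1ʳ) formally contains.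

## Level 1 — the refit as a BRIDGE: (LAW) ∧ (RF) ∧ (ENV) ∧ (DOM) ⟹ (F1ʳ-cap)

* **(RF) `AffineRefit 𝓘₀ 𝓘₁ τ τ₁ κN κA T`** [KINEMATIC] — an admissible cluster charted (`τ`, `t ≤ T z₀`) by an instance of `𝓘₀` is charted (`τ₁`, `κA·t`) by a
  level-near (`κN·t`) instance of `𝓘₁` with PROJECTED deviation: on the uncapped annulus the new deviation is the least-squares affine-free residual
  `(1 − P)u` of a field `u` of sup `≤ t` (`projectedFree`; the refit `z₁ = (1+A)·z₀` re-cut to the `133/10`-ball, `A` the least-squares linear part).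
* **(ENV_P) `FamilyEnvelopeOn P 𝓘 τ κA tmax Ψ`** [ANALYTIC, decomposed at level 2] — the plain envelope on `𝓘` for charts (`τ`, `κA·t`) satisfying the chart
  predicate `P … t`, `0 ≤ t ≤ tmax`, modulus `Ψ(z₁)(t)` indexed by the CHARTING instance and the ORIGINAL roughness `t` (so the census's affine-quotiented
  columns `‖g_na‖₁·t` apply with no amplification: `⟨g, (1−P)u⟩ = ⟨(1−P)ᵀg, u⟩`).
* **(DOM) `RefitDomination 𝓘₀ 𝓘₁ κN T Ψ Φ`** [TABLE CERTIFICATE over level-near pairs · INSTRUMENTABLE] — `Ψ(z₁)(t) ≤ Φ(z₀)(t)`, `0 ≤ t ≤ T(z₀)`.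
* **(LAW) `LawLE 𝓘₀ T tmax`** [PROVED for `T₀`, `tmax = 1/60`, `η₃ ≤ 1/16`].
★ SEAM `familyEnvelopeRefitCap_of_pieces` (one `linarith`).  TRADE `familyEnvelopeRefitCap_of_plainOn`: a plain capped envelope on `𝓘₀ ≤ 𝓘₁` gives (F1ʳ-cap).

## The record: why the comparison family is RE-PINNED window-free (LINE A⁺)

On the pins of LINE A the comparison family `bentFamily 𝓑₀ (7/100)` inherits the CLUSTER-side admissibility window (`¬TightNearCap`: level `≥ 1/20`), so
(RF) fails in the bottom collar: a chart instance of level `1/20 + β`, `β < κN₀·t`, may refit to level `< 1/20`, where that family is EMPTY — while without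
refit the raw slack column exceeds the affine-quotiented one by `≈ 2.6·10⁻⁴ > B₀ = 10⁻⁴` at the edge (instruments SLACK50 / SLACK52), so `Φ₀` cannot be met
there either.  Comparison instances are not clusters: nothing requires them admissible.  LINE A⁺ re-pins ONLY the comparison family:
`𝓘₁⁺ := compFamily 𝓑₁ (7/100)` — injective, separated, in the `133/10`-ball, bent by `𝓑₁ := polyBends (11/2000) (11/20000)` (`𝓑₀` inflated by `1.1 ≥ (1+|A|)³`,
the conjugation `(1+A)b(1+A)⁻¹`), `7/100`-good centre, NO window / exemption / badness clause — and the coarse comparison tolerance `τ₁ = 7/20 ≥ τ₀ + |A|·63/10`.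
Its level constant is `κN₁ = 1/3` (the adversarial least-squares bound `0.28·t` on the refit's level shift beats LINE A's `1/4`) and its modulus `Φ₁` is `Φ₀`
with every table read at the SHIFTED level `x + κN₁t` (`levelTableShift`; `Phi0_le_Phi1`) — critic row 924 (c).  (F1ʳ-cap-bent₀) ⟹ (F1ʳ-cap-bent₁)
(`familyEnvelopeCapBent1_of_capBent0`) and (F3-bent₁) ⟹ (F3-bent₀) (`familyCertBent0_of_certBent1`): LINE A⁺ is (F1)-easier and (F3)-harder by exactly the
level shift and the pairs whose comparison instance lies `≤ κN₁T₀ ≤ 1/180` below the window (score continuous there; census ask BUDGET53).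
-/
namespace Summit.AtomisticToContinuum.Crystallization.Theorems.FrustratedLawDichotomyStrainedPatchEnvelopeLaw

open scoped BigOperators Classical
open Summit.AtomisticToContinuum.Crystallization.Theorems.FrustratedLawDichotomyPeriodicBlockFlags (goodAtScale_mono)
open Summit.AtomisticToContinuum.Crystallization.Theorems.FrustratedLawDichotomyRangeCut (Sep)
open Summit.AtomisticToContinuum.Crystallization.Theorems.FrustratedLawDichotomyMotifLemmas
open Summit.AtomisticToContinuum.Crystallization.Theorems.FrustratedLawDichotomyAveragingCut
open Summit.AtomisticToContinuum.Crystallization.Theorems.FrustratedLawDichotomyAveragingRuleCap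
open Summit.AtomisticToContinuum.Crystallization.Theorems.FrustratedLawDichotomyAveragingRuleTightFree
open Summit.AtomisticToContinuum.Crystallization.Theorems.FrustratedLawDichotomyExemptDoor (SitePred)
open Summit.AtomisticToContinuum.Crystallization.Theorems.FrustratedLawDichotomyExemptAbsorption
open Summit.AtomisticToContinuum.Crystallization.Theorems.FrustratedLawDichotomyExemptAbsorptionRecord
open Summit.AtomisticToContinuum.Crystallization.Theorems.FrustratedLawDichotomyCollarCensus
open Summit.AtomisticToContinuum.Crystallization.Theorems.FrustratedLawDichotomyCollarCensusKappa
open Summit.AtomisticToContinuum.Crystallization.Theorems.FrustratedLawDichotomyStrainedPatchHomSplit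
open Summit.AtomisticToContinuum.Crystallization.Theorems.FrustratedLawDichotomyStrainedPatchCleanCollar
open Summit.AtomisticToContinuum.Crystallization.Theorems.FrustratedLawDichotomyStrainedPatchHomTube
open Summit.AtomisticToContinuum.Crystallization.Theorems.FrustratedLawDichotomyStrainedPatchHomIsometry
open Summit.AtomisticToContinuum.Crystallization.Theorems.FrustratedLawDichotomyStrainedPatchHomTubeIso
open Summit.AtomisticToContinuum.Crystallization.Theorems.FrustratedLawDichotomyStrainedPatchPhaseCut
open Summit.AtomisticToContinuum.Crystallization.Theorems.FrustratedLawDichotomyStrainedPatchCoreTube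
open Summit.AtomisticToContinuum.Crystallization.Theorems.FrustratedLawDichotomyStrainedPatchCoreTubeRecord
open Summit.AtomisticToContinuum.Crystallization.Theorems.FrustratedLawDichotomyStrainedPatchCoreTubeMilli
open Summit.AtomisticToContinuum.Crystallization.Theorems.FrustratedLawDichotomyStrainedPatchStrainBands
open Summit.AtomisticToContinuum.Crystallization.Theorems.FrustratedLawDichotomyStrainedPatchChartFamilies
open Summit.AtomisticToContinuum.Crystallization.Theorems.FrustratedLawDichotomyStrainedPatchChartFamiliesBent
open Summit.AtomisticToContinuum.Crystallization.Theorems.FrustratedLawDichotomyStrainedPatchChartFamiliesPinned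

/-! ## §0. Level 0 — the law-capped refit envelope (free weakening of (F1ʳ)) and its seam -/

/-- **(F1ʳ-cap) `FamilyEnvelopeRefitCap 𝓘₀ 𝓘₁ τ κN Φ T`** [ANALYTIC] — (F1ʳ) `FamilyEnvelopeRefit` restricted to fine deviations BELOW THE LAW: `t ≤ T(z₀)`.
This is all the refit seam consumes ((F2) produces the chart at `t = T(z₀)`). -/
def FamilyEnvelopeRefitCap (𝓘₀ 𝓘₁ : (M₀ : ℕ) → (Fin M₀ → E3) → Fin M₀ → Prop) (τ κN : ℝ) (Φ : (M₀ : ℕ) → (Fin M₀ → E3) → Fin M₀ → ℝ → ℝ)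
    (T : (M₀ : ℕ) → (Fin M₀ → E3) → Fin M₀ → ℝ) : Prop :=
  ∀ (M : ℕ) (z : Fin M → E3) (c : Fin M) (M₀ : ℕ) (z₀ : Fin M₀ → E3) (c₀ : Fin M₀) (e : Fin M → Fin M₀) (t : ℝ),
    Admissible M z c → CleanBall (63 / 10) z c → MonoPhaseBall (63 / 10) z c → 0 ≤ t → t ≤ T M₀ z₀ c₀ → ChartBy 𝓘₀ τ t z c z₀ c₀ e →
      ∃ (M₁ : ℕ) (z₁ : Fin M₁ → E3) (c₁ : Fin M₁), 𝓘₁ M₁ z₁ c₁ ∧ LevelNear κN t z₀ c₀ z₁ c₁ ∧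
        ballAvg (9 / 5) z₁ (xRec M₁ z₁) c₁ - Φ M₀ z₀ c₀ t ≤ ballAvg (9 / 5) z (xRec M z) c

/-- ★ THE TRADE, level 0: (F1ʳ) ⟹ (F1ʳ-cap) for every law (drop the cap). [formal bookkeeping] -/
theorem familyEnvelopeRefitCap_of_refit {𝓘₀ 𝓘₁ : (M₀ : ℕ) → (Fin M₀ → E3) → Fin M₀ → Prop} {τ κN : ℝ} {Φ : (M₀ : ℕ) → (Fin M₀ → E3) → Fin M₀ → ℝ → ℝ}
    (h : FamilyEnvelopeRefit 𝓘₀ 𝓘₁ τ κN Φ) (T : (M₀ : ℕ) → (Fin M₀ → E3) → Fin M₀ → ℝ) : FamilyEnvelopeRefitCap 𝓘₀ 𝓘₁ τ κN Φ T :=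
  fun M z c M₀ z₀ c₀ e t hz hcl hm ht _ hch => h M z c M₀ z₀ c₀ e t hz hcl hm ht hch

/-- (F1ʳ-cap) is antitone in the law. [formal bookkeeping] -/
theorem FamilyEnvelopeRefitCap.anti_law {𝓘₀ 𝓘₁ : (M₀ : ℕ) → (Fin M₀ → E3) → Fin M₀ → Prop} {τ κN : ℝ} {Φ : (M₀ : ℕ) → (Fin M₀ → E3) → Fin M₀ → ℝ → ℝ}
    {T T' : (M₀ : ℕ) → (Fin M₀ → E3) → Fin M₀ → ℝ} (h : FamilyEnvelopeRefitCap 𝓘₀ 𝓘₁ τ κN Φ T')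
    (hle : ∀ (M₀ : ℕ) (z₀ : Fin M₀ → E3) (c₀ : Fin M₀), T M₀ z₀ c₀ ≤ T' M₀ z₀ c₀) : FamilyEnvelopeRefitCap 𝓘₀ 𝓘₁ τ κN Φ T :=
  fun M z c M₀ z₀ c₀ e t hz hcl hm ht htT hch => h M z c M₀ z₀ c₀ e t hz hcl hm ht (htT.trans (hle M₀ z₀ c₀)) hch

/-- (F1ʳ-cap) is monotone in the comparison family (more comparison instances, weaker statement). [formal bookkeeping] -/
theorem FamilyEnvelopeRefitCap.mono_target {𝓘₀ 𝓘₁ 𝓘₁' : (M₀ : ℕ) → (Fin M₀ → E3) → Fin M₀ → Prop} {τ κN : ℝ}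
    {Φ : (M₀ : ℕ) → (Fin M₀ → E3) → Fin M₀ → ℝ → ℝ} {T : (M₀ : ℕ) → (Fin M₀ → E3) → Fin M₀ → ℝ} (h : FamilyEnvelopeRefitCap 𝓘₀ 𝓘₁ τ κN Φ T)
    (hle : FamilyLE 𝓘₁ 𝓘₁') : FamilyEnvelopeRefitCap 𝓘₀ 𝓘₁' τ κN Φ T := by
  intro M z c M₀ z₀ c₀ e t hz hcl hm ht htT hch
  obtain ⟨M₁, z₁, c₁, hI₁, hN, h₁⟩ := h M z c M₀ z₀ c₀ e t hz hcl hm ht htT hch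
  exact ⟨M₁, z₁, c₁, hle M₁ z₁ c₁ hI₁, hN, h₁⟩

/-- ★★ THE CAPPED REFIT SEAM: (F1ʳ-cap) ∧ (F2 on the chart family) ∧ (F3ʳ) ⟹ `EdgeFarFloor (63/10) (63/10) ρ ε η₂ φ` (the proof of `edgeFar_of_familyRefit`
with the cap discharged by `le_refl`). [folklore] -/
theorem edgeFar_of_familyRefitCap {𝓘₀ 𝓘₁ : (M₀ : ℕ) → (Fin M₀ → E3) → Fin M₀ → Prop} {ρ ε η₂ τ κN φ : ℝ} {Φ : (M₀ : ℕ) → (Fin M₀ → E3) → Fin M₀ → ℝ → ℝ}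
    {T : (M₀ : ℕ) → (Fin M₀ → E3) → Fin M₀ → ℝ} (hE : FamilyEnvelopeRefitCap 𝓘₀ 𝓘₁ τ κN Φ T) (hR : FamilyRoom 𝓘₀ ρ ε η₂ τ T)
    (hC : FamilyCertRefit 𝓘₀ 𝓘₁ κN φ Φ T) : EdgeFarFloor (63 / 10) (63 / 10) ρ ε η₂ φ := by
  intro M z c hz hcl hm hn hg
  obtain ⟨R, M₀, z₀, c₀, e, ht, hch⟩ := hR M z c hz hcl hm hn hg
  obtain ⟨M₁, z₁, c₁, hI₁, hN, h₁⟩ := hE M (⇑R ∘ z) c M₀ z₀ c₀ e _ ((admissible_comp_iff R z c).2 hz) ((cleanBall_comp_iff R z c).2 hcl)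
    ((monoPhaseBall_comp_iff R z c).2 hm) ht le_rfl hch
  rw [ballAvg_xRec_comp] at h₁
  have h₃ := hC M₀ z₀ c₀ M₁ z₁ c₁ hch.1 hI₁ hN
  linarith

/-- ★★ THE CAPPED REFIT NODE: (F1ʳ-cap) ∧ (F2) ∧ (F3ʳ) ∧ `BandFarFloor … ηE η₂ φ` [BRIDGE] ∧ `SoftFarFloor … η₂ φ` [RESIDUAL] ⟹ `CoreOffTubeFloor (63/10) (63/10) ρ ε φ`.
[folklore] -/
theorem coreOff_of_familyRefitCap_of_band_of_soft {𝓘₀ 𝓘₁ : (M₀ : ℕ) → (Fin M₀ → E3) → Fin M₀ → Prop} {ρ ε ηE η₂ τ κN φ : ℝ}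
    {Φ : (M₀ : ℕ) → (Fin M₀ → E3) → Fin M₀ → ℝ → ℝ} {T : (M₀ : ℕ) → (Fin M₀ → E3) → Fin M₀ → ℝ} (hE : FamilyEnvelopeRefitCap 𝓘₀ 𝓘₁ τ κN Φ T)
    (hR : FamilyRoom 𝓘₀ ρ ε ηE τ T) (hC : FamilyCertRefit 𝓘₀ 𝓘₁ κN φ Φ T) (hB : BandFarFloor (63 / 10) (63 / 10) ρ ε ηE η₂ φ)
    (hS : SoftFarFloor (63 / 10) (63 / 10) ρ ε η₂ φ) : CoreOffTubeFloor (63 / 10) (63 / 10) ρ ε φ :=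
  coreOff_of_edge_of_band_of_soft (edgeFar_of_familyRefitCap hE hR hC) hB hS

/-! ## §1. The law of record is bounded: `T₀ ≤ 1/24` everywhere, `T₀ ≤ 1/60` on the chart families (`η₃ ≤ 1/16`) -/

/-- A good site's tolerance is positive (the fit clause `‖…‖ ≤ η'·d` at one of the twelve pattern points, `d > 0`, `η' < η`). [folklore] -/
theorem goodAtScale_pos {η D : ℝ} {M : ℕ} {z : Fin M → E3} {a : Fin M} (h : GoodAtScale η D z a) : 0 < η := by
  obtain ⟨d, η₀, γ, A, -, hor⟩ := h
  rcases hor with ⟨t, hd, -, hη, hfit, -⟩ | ⟨t, hd, -, hη, hfit, -⟩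
  · obtain ⟨u, hu⟩ := Finset.card_pos.mp (by rw [Literature.Geometry.DiscreteGeometry.card_fccKissingPattern]; norm_num)
    have h0 : 0 ≤ η₀ * d := (norm_nonneg _).trans (hfit ⟨u, hu⟩).2
    nlinarith
  · obtain ⟨u, hu⟩ := Finset.card_pos.mp (by rw [Literature.Geometry.DiscreteGeometry.card_hcpKissingPattern]; norm_num)
    have h0 : 0 ≤ η₀ * d := (norm_nonneg _).trans (hfit ⟨u, hu⟩).2
    nlinarith

/-- The fit level is at most any tolerance at which the site is good. [folklore] -/
theorem fitLevel_le_of_goodAtScale {η : ℝ} {M : ℕ} {z : Fin M → E3} {a : Fin M} (h : GoodAtScale η (3 / 2) z a) : fitLevel z a ≤ η :=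
  csInf_le ⟨0, fun _ hη' => (goodAtScale_pos hη').le⟩ h

/-- The window room never exceeds half the window's width: `windowRoom ≤ 3/80`. [formal bookkeeping] -/
theorem windowRoom_le {M : ℕ} (z : Fin M → E3) (c : Fin M) : windowRoom z c ≤ 3 / 80 := by
  unfold windowRoom
  rcases le_total (fitLevel z c - 1 / 20) (1 / 8 - fitLevel z c) with h | h
  · rw [min_eq_left h]; linarith
  · rw [min_eq_right h]; linarith

/-- `T₀ ≤ 1/24` on every instance (`3/80 + (3/10)σ₁ < 1/24`, `σ₁ < 108/10⁴`). [formal bookkeeping] -/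
theorem T0_le (M₀ : ℕ) (z₀ : Fin M₀ → E3) (c₀ : Fin M₀) : T0 M₀ z₀ c₀ ≤ 1 / 24 := by
  rw [T0_eq]; have := windowRoom_le z₀ c₀; have := sigmaOne_lt; linarith

/-- `T₀ ≤ 1/60` at every `1/16`-good centre (`windowRoom ≤ fitLevel − 1/20 ≤ 1/80`, `1/80 + (3/10)σ₁ < 1/60`). [formal bookkeeping] -/
theorem T0_le_of_goodAtScale {M₀ : ℕ} {z₀ : Fin M₀ → E3} {c₀ : Fin M₀} (h : GoodAtScale (1 / 16) (3 / 2) z₀ c₀) : T0 M₀ z₀ c₀ ≤ 1 / 60 := by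
  rw [T0_eq]; have := fitLevel_le_of_goodAtScale h; have := sigmaOne_lt
  have : windowRoom z₀ c₀ ≤ fitLevel z₀ c₀ - 1 / 20 := min_le_left _ _
  linarith

/-- **(LAW) `LawLE 𝓘 T tmax`** — the law is at most `tmax` on the family. -/
def LawLE (𝓘 : (M₀ : ℕ) → (Fin M₀ → E3) → Fin M₀ → Prop) (T : (M₀ : ℕ) → (Fin M₀ → E3) → Fin M₀ → ℝ) (tmax : ℝ) : Prop :=
  ∀ (M₀ : ℕ) (z₀ : Fin M₀ → E3) (c₀ : Fin M₀), 𝓘 M₀ z₀ c₀ → T M₀ z₀ c₀ ≤ tmax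

/-- (LAW) for the law of record on every bent chart family with `η₃ ≤ 1/16`: `T₀ ≤ 1/60`. [formal bookkeeping] -/
theorem lawLE_T0_bent (𝓑 : Set (E3 → E3)) {η₃ : ℝ} (h : η₃ ≤ 1 / 16) : LawLE (bentFamily 𝓑 η₃) T0 (1 / 60) :=
  fun _ _ _ hI => T0_le_of_goodAtScale (goodAtScale_mono h hI.2.2)

/-- (LAW) for the law of record on any family: `T₀ ≤ 1/24`. [formal bookkeeping] -/
theorem lawLE_T0 (𝓘 : (M₀ : ℕ) → (Fin M₀ → E3) → Fin M₀ → Prop) : LawLE 𝓘 T0 (1 / 24) := fun M₀ z₀ c₀ _ => T0_le M₀ z₀ c₀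

/-! ## §2. Level 1 — the deviation field, chart predicates, the three refit pieces, the seam -/

/-- The UNCAPPED ANNULUS of the charted ball: sites of the `63/10`-ball farther than `9/2` from every `9/5`-member (where `ChartBy` measures `t`). -/
noncomputable def uncapped {M : ℕ} (z : Fin M → E3) (c : Fin M) : Finset (Fin M) :=
  (ball (63 / 10) z c).filter (fun a => ∀ j ∈ ball (9 / 5) z c, 9 / 2 < dist (z a) (z j))

/-- The DEVIATION FIELD of a chart: `dev a = (z a − z c) − (z₁ (e a) − z₁ c₁)`. -/
def dev {M : ℕ} (z : Fin M → E3) (c : Fin M) {M₁ : ℕ} (z₁ : Fin M₁ → E3) (c₁ : Fin M₁) (e : Fin M → Fin M₁) (a : Fin M) : E3 :=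
  (z a - z c) - (z₁ (e a) - z₁ c₁)

/-- **`projectedFree … t`** [chart predicate] — on the uncapped annulus the deviation field is the least-squares AFFINE-FREE RESIDUAL of a field of sup `≤ t`:
the normal equations `Σ_{a ∈ U} dev(a)_i · (z₁ (e a) − z₁ c₁)_j = 0` hold, and `dev = u − L(z₁ (e ·) − z₁ c₁)` on `U` for a linear `L` and a field `‖u‖ ≤ t`. -/
def projectedFree (M : ℕ) (z : Fin M → E3) (c : Fin M) (M₁ : ℕ) (z₁ : Fin M₁ → E3) (c₁ : Fin M₁) (e : Fin M → Fin M₁) (t : ℝ) : Prop :=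
  (∀ i j : Fin 3, ∑ a ∈ uncapped z c, dev z c z₁ c₁ e a i * (z₁ (e a) - z₁ c₁) j = 0) ∧
    ∃ (L : E3 →ₗ[ℝ] E3) (u : Fin M → E3), (∀ a ∈ uncapped z c, ‖u a‖ ≤ t) ∧ ∀ a ∈ uncapped z c, dev z c z₁ c₁ e a = u a - L (z₁ (e a) - z₁ c₁)

/-- **`anyChart`** [chart predicate] — no restriction. -/
def anyChart (M : ℕ) (_ : Fin M → E3) (_ : Fin M) (M₁ : ℕ) (_ : Fin M₁ → E3) (_ : Fin M₁) (_ : Fin M → Fin M₁) (_ : ℝ) : Prop := True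

/-- **(ENV_P) `FamilyEnvelopeOn P 𝓘 τ κA tmax Ψ`** [ANALYTIC; decomposed at level 2] — the plain envelope on `𝓘` for admissible clean mono-phase clusters charted
(`τ`, fine `κA·t`) with chart predicate `P … t`, `0 ≤ t ≤ tmax`: `S(z₁) − Ψ(z₁)(t) ≤ S(z)`. -/
def FamilyEnvelopeOn (P : (M : ℕ) → (Fin M → E3) → Fin M → (M₁ : ℕ) → (Fin M₁ → E3) → Fin M₁ → (Fin M → Fin M₁) → ℝ → Prop)
    (𝓘 : (M₀ : ℕ) → (Fin M₀ → E3) → Fin M₀ → Prop) (τ κA tmax : ℝ) (Ψ : (M₀ : ℕ) → (Fin M₀ → E3) → Fin M₀ → ℝ → ℝ) : Prop :=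
  ∀ (M : ℕ) (z : Fin M → E3) (c : Fin M) (M₁ : ℕ) (z₁ : Fin M₁ → E3) (c₁ : Fin M₁) (e : Fin M → Fin M₁) (t : ℝ),
    Admissible M z c → CleanBall (63 / 10) z c → MonoPhaseBall (63 / 10) z c → 0 ≤ t → t ≤ tmax → ChartBy 𝓘 τ (κA * t) z c z₁ c₁ e →
      P M z c M₁ z₁ c₁ e t → ballAvg (9 / 5) z₁ (xRec M₁ z₁) c₁ - Ψ M₁ z₁ c₁ t ≤ ballAvg (9 / 5) z (xRec M z) c

/-- **(RF) `AffineRefit 𝓘₀ 𝓘₁ τ τ₁ κN κA T`** [KINEMATIC] — every admissible cluster charted (coarse `τ`, fine `t ≤ T(z₀)`) by an instance of `𝓘₀` is charted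
(coarse `τ₁`, fine `κA·t`) by an instance of `𝓘₁` whose fit level is within `κN·t` of `z₀`'s, with PROJECTED affine-free deviation on the uncapped annulus
(the refit `z₁ = (1+A)·z₀` re-cut to the `133/10`-ball, `A` the least-squares linear part of the deviation, `|A| ≲ 0.26·t`). -/
def AffineRefit (𝓘₀ 𝓘₁ : (M₀ : ℕ) → (Fin M₀ → E3) → Fin M₀ → Prop) (τ τ₁ κN κA : ℝ) (T : (M₀ : ℕ) → (Fin M₀ → E3) → Fin M₀ → ℝ) : Prop :=
  ∀ (M : ℕ) (z : Fin M → E3) (c : Fin M) (M₀ : ℕ) (z₀ : Fin M₀ → E3) (c₀ : Fin M₀) (e : Fin M → Fin M₀) (t : ℝ),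
    Admissible M z c → CleanBall (63 / 10) z c → MonoPhaseBall (63 / 10) z c → 0 ≤ t → t ≤ T M₀ z₀ c₀ → ChartBy 𝓘₀ τ t z c z₀ c₀ e →
      ∃ (M₁ : ℕ) (z₁ : Fin M₁ → E3) (c₁ : Fin M₁) (e₁ : Fin M → Fin M₁),
        𝓘₁ M₁ z₁ c₁ ∧ LevelNear κN t z₀ c₀ z₁ c₁ ∧ ChartBy 𝓘₁ τ₁ (κA * t) z c z₁ c₁ e₁ ∧ projectedFree M z c M₁ z₁ c₁ e₁ t

/-- **(DOM) `RefitDomination 𝓘₀ 𝓘₁ κN T Ψ Φ`** [TABLE CERTIFICATE over level-near pairs, INSTRUMENTABLE] — the level-2 modulus at the comparison instance is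
dominated by the pinned modulus at the chart instance: `Ψ(z₁)(t) ≤ Φ(z₀)(t)` whenever `z₀ ∈ 𝓘₀`, `z₁ ∈ 𝓘₁` are `κN·t`-level-near and `0 ≤ t ≤ T(z₀)`. -/
def RefitDomination (𝓘₀ 𝓘₁ : (M₀ : ℕ) → (Fin M₀ → E3) → Fin M₀ → Prop) (κN : ℝ) (T : (M₀ : ℕ) → (Fin M₀ → E3) → Fin M₀ → ℝ)
    (Ψ Φ : (M₀ : ℕ) → (Fin M₀ → E3) → Fin M₀ → ℝ → ℝ) : Prop :=
  ∀ (M₀ : ℕ) (z₀ : Fin M₀ → E3) (c₀ : Fin M₀) (M₁ : ℕ) (z₁ : Fin M₁ → E3) (c₁ : Fin M₁) (t : ℝ), 𝓘₀ M₀ z₀ c₀ → 𝓘₁ M₁ z₁ c₁ →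
    0 ≤ t → t ≤ T M₀ z₀ c₀ → LevelNear κN t z₀ c₀ z₁ c₁ → Ψ M₁ z₁ c₁ t ≤ Φ M₀ z₀ c₀ t

/-- ★★ THE LEVEL-1 SEAM: (LAW) ∧ (RF) ∧ (ENV_projectedFree on `𝓘₁`, `τ₁`, `κA`, `tmax`) ∧ (DOM) ⟹ (F1ʳ-cap).  One `linarith`. [folklore] -/
theorem familyEnvelopeRefitCap_of_pieces {𝓘₀ 𝓘₁ : (M₀ : ℕ) → (Fin M₀ → E3) → Fin M₀ → Prop} {τ τ₁ κN κA tmax : ℝ}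
    {T : (M₀ : ℕ) → (Fin M₀ → E3) → Fin M₀ → ℝ} {Ψ Φ : (M₀ : ℕ) → (Fin M₀ → E3) → Fin M₀ → ℝ → ℝ} (hT : LawLE 𝓘₀ T tmax)
    (hRF : AffineRefit 𝓘₀ 𝓘₁ τ τ₁ κN κA T) (hE : FamilyEnvelopeOn projectedFree 𝓘₁ τ₁ κA tmax Ψ) (hD : RefitDomination 𝓘₀ 𝓘₁ κN T Ψ Φ) :
    FamilyEnvelopeRefitCap 𝓘₀ 𝓘₁ τ κN Φ T := by
  intro M z c M₀ z₀ c₀ e t hz hcl hm ht htT hch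
  obtain ⟨M₁, z₁, c₁, e₁, hI₁, hN, hch₁, hP⟩ := hRF M z c M₀ z₀ c₀ e t hz hcl hm ht htT hch
  have h₁ := hE M z c M₁ z₁ c₁ e₁ t hz hcl hm ht (htT.trans (hT M₀ z₀ c₀ hch.1)) hch₁ hP
  have h₂ := hD M₀ z₀ c₀ M₁ z₁ c₁ t hch.1 hI₁ ht htT hN
  exact ⟨M₁, z₁, c₁, hI₁, hN, by linarith⟩

/-- ★ THE TRADE, level 1: a plain capped envelope on the whole chart family (no refit: `κA = 1`, any chart) GIVES (F1ʳ-cap) outright (`𝓘₀ ≤ 𝓘₁`, `κN ≥ 0`,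
modulus dominated below the law). [formal bookkeeping] -/
theorem familyEnvelopeRefitCap_of_plainOn {𝓘₀ 𝓘₁ : (M₀ : ℕ) → (Fin M₀ → E3) → Fin M₀ → Prop} {τ κN tmax : ℝ} {T : (M₀ : ℕ) → (Fin M₀ → E3) → Fin M₀ → ℝ}
    {Ψ Φ : (M₀ : ℕ) → (Fin M₀ → E3) → Fin M₀ → ℝ → ℝ} (hκN : 0 ≤ κN) (hI : FamilyLE 𝓘₀ 𝓘₁) (hT : LawLE 𝓘₀ T tmax)
    (hE : FamilyEnvelopeOn anyChart 𝓘₀ τ 1 tmax Ψ)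
    (hD : ∀ (M₀ : ℕ) (z₀ : Fin M₀ → E3) (c₀ : Fin M₀) (t : ℝ), 𝓘₀ M₀ z₀ c₀ → 0 ≤ t → t ≤ T M₀ z₀ c₀ → Ψ M₀ z₀ c₀ t ≤ Φ M₀ z₀ c₀ t) :
    FamilyEnvelopeRefitCap 𝓘₀ 𝓘₁ τ κN Φ T := by
  intro M z c M₀ z₀ c₀ e t hz hcl hm ht htT hch
  have h₁ := hE M z c M₀ z₀ c₀ e t hz hcl hm ht (htT.trans (hT M₀ z₀ c₀ hch.1)) (by rwa [one_mul]) trivial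
  have h₂ := hD M₀ z₀ c₀ t hch.1 ht htT
  exact ⟨M₀, z₀, c₀, hI M₀ z₀ c₀ hch.1, levelNear_refl hκN t z₀ c₀, by linarith⟩

/-! ## §3. The record: (F1ʳ-cap-bent₀); LINE A⁺ (window-free comparison family `𝓘₁⁺`, `κN₁ = 1/3`, shifted modulus `Φ₁`); pins `κA₀ = 2`, `τ₁ = 7/20`, `tmax₀ = 1/60` -/

/-- ★ **(F1ʳ-cap-bent₀) OF RECORD** `:= FamilyEnvelopeRefitCap (bentFamily 𝓑₀ (1/16)) (bentFamily 𝓑₀ (7/100)) (1/4) (1/4) Φ₀ T₀` — (F1-bent₀) below the law. -/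
def FamilyEnvelopeCapBent0 : Prop := FamilyEnvelopeRefitCap (bentFamily bends0 eta00) (bentFamily bends0 eta30) tau0 kN0 Phi0 T0

/-- (F1-bent₀) ⟹ (F1ʳ-cap-bent₀). [formal bookkeeping] -/
theorem familyEnvelopeCapBent0_of_bent0 (h : FamilyEnvelopeBent0) : FamilyEnvelopeCapBent0 := familyEnvelopeRefitCap_of_refit h T0

/-- ★★ LINE A, EDGE BAND, capped: (F1ʳ-cap-bent₀) ∧ (F2-bent₀) ∧ (F3-bent₀) ⟹ `EdgeFarFloor (63/10) (63/10) (24/5) (1/100) (3/50) 0`. [folklore] -/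
theorem edgeFar_capBent0 (hE : FamilyEnvelopeCapBent0) (hR : FamilyRoomBent0) (hC : FamilyCertBent0) :
    EdgeFarFloor (63 / 10) (63 / 10) (24 / 5) (1 / 100) (3 / 50) 0 :=
  edgeFar_of_familyRefitCap hE hR hC

/-- **`compFamily 𝓑 η₃`** — the WINDOW-FREE comparison family: injective, separated instances in the `133/10`-ball, bent by `𝓑`, with an `η₃`-good centre (no
admissibility window, no exemption or badness clause: comparison instances are not clusters). -/
def compFamily (𝓑 : Set (E3 → E3)) (η₃ : ℝ) : (M₁ : ℕ) → (Fin M₁ → E3) → Fin M₁ → Prop :=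
  fun _ z₁ c₁ => Function.Injective z₁ ∧ Sep z₁ ∧ (∀ a, dist (z₁ a) (z₁ c₁) ≤ 133 / 10) ∧ IsBentBall 𝓑 (133 / 10) z₁ c₁ ∧ GoodAtScale η₃ (3 / 2) z₁ c₁

/-- `bentFamily 𝓑 η₃ ≤ compFamily 𝓑' η₃'` for `𝓑 ⊆ 𝓑'`, `η₃ ≤ η₃'`. [formal bookkeeping] -/
theorem bentFamily_le_compFamily {𝓑 𝓑' : Set (E3 → E3)} (hB : 𝓑 ⊆ 𝓑') {η₃ η₃' : ℝ} (hle : η₃ ≤ η₃') : FamilyLE (bentFamily 𝓑 η₃) (compFamily 𝓑' η₃') := by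
  rintro M₀ z₁ c₁ ⟨hz, ⟨b, z₀, hb, hhom, hab⟩, hg⟩
  exact ⟨hz.1, hz.2.1, hz.2.2.1, ⟨b, z₀, hB hb, hhom, hab⟩, goodAtScale_mono hle hg⟩

/-- ★ THE COMPARISON BENDING CLASS `𝓑₁ := polyBends (11/2000) (11/20000)` (`𝓑₀` inflated by `11/10 ≥ (1+|A|)³`: conjugating a bend by the refit). -/
def bends1 : Set (E3 → E3) := polyBends (11 / 2000) (11 / 20000)

/-- `𝓑₀ ⊆ 𝓑₁`. [formal bookkeeping] -/
theorem bends0_subset_bends1 : bends0 ⊆ bends1 := polyBends_mono (by norm_num) (by norm_num)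

/-- ★ **THE COMPARISON FAMILY OF LINE A⁺** `𝓘₁⁺ := compFamily 𝓑₁ (7/100)`. -/
def CompFamily1 : (M₁ : ℕ) → (Fin M₁ → E3) → Fin M₁ → Prop := compFamily bends1 eta30

/-- `bentFamily 𝓑₀ (7/100) ≤ 𝓘₁⁺` (hence the chart family too). [formal bookkeeping] -/
theorem comparison0_le_compFamily1 : FamilyLE (bentFamily bends0 eta30) CompFamily1 := bentFamily_le_compFamily bends0_subset_bends1 le_rfl

/-- ★ LINE A⁺ pin: the refit level constant `κN₁ = 1/3` (`≥` the adversarial least-squares bound `0.28`; LINE A had `κN₀ = 1/4`; critic row 924 (c1)). -/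
noncomputable def kN1 : ℝ := 1 / 3

/-- **`levelTableShift af bf cf ah bh ch`** — the phase-aware quadratic table of `…ChartFamiliesPinned.levelTable` read at the SHIFTED level `x + s`,
`x := fitLevel z₀ c₀ − 1/20` (the comparison instance of a `κN·t`-level-near pair may sit `s = κN·t` above the chart instance). -/
noncomputable def levelTableShift (af bf cf ah bh ch : ℝ) : (M₀ : ℕ) → (Fin M₀ → E3) → Fin M₀ → ℝ → ℝ :=
  fun _ z₀ c₀ s => if FccGoodAtScale (1 / 8) (3 / 2) z₀ c₀ then af + bf * (fitLevel z₀ c₀ - 1 / 20 + s) + cf * (fitLevel z₀ c₀ - 1 / 20 + s) ^ 2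
    else ah + bh * (fitLevel z₀ c₀ - 1 / 20 + s) + ch * (fitLevel z₀ c₀ - 1 / 20 + s) ^ 2

/-- LINE A⁺ table `ℓ₁` = `ell0`'s coefficients at the shifted level. -/
noncomputable def ell1 : (M₀ : ℕ) → (Fin M₀ → E3) → Fin M₀ → ℝ → ℝ := levelTableShift (3 / 50) (53 / 40) (11 / 2) (93 / 2000) (7 / 10) (35 / 2)
/-- LINE A⁺ table `ℓx₁` = `ellx0`'s coefficients at the shifted level. -/
noncomputable def ellx1 : (M₀ : ℕ) → (Fin M₀ → E3) → Fin M₀ → ℝ → ℝ := levelTableShift (33 / 1000) (17 / 40) 11 (9 / 500) (2 / 5) 7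
/-- LINE A⁺ table `sw₁` = `sw0`'s coefficients at the shifted level. -/
noncomputable def sw1 : (M₀ : ℕ) → (Fin M₀ → E3) → Fin M₀ → ℝ → ℝ := levelTableShift (47 / 50000) (3 / 200) (3 / 20) (41 / 50000) (1 / 80) (1 / 4)

/-- ★ **THE MODULUS OF LINE A⁺ `Φ₁`** — `Φ₀`'s formula with every table read at the shifted level `x + κN₁·t` (critic row 924 (c2); margin cost `≈ 0.33·T₀² ≤ 10⁻⁴`):
`Φ₁(z₀)(t) = ℓ₁(κN₁t)·t + sw₁(κN₁t) + t²/4 + (ℓx₁(κN₁t)·T₀ + 10⁻⁴)`. -/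
noncomputable def Phi1 : (M₀ : ℕ) → (Fin M₀ → E3) → Fin M₀ → ℝ → ℝ :=
  fun M₀ z₀ c₀ t => ell1 M₀ z₀ c₀ (kN1 * t) * t + sw1 M₀ z₀ c₀ (kN1 * t) + 1 / 4 * t ^ 2 + (ellx1 M₀ z₀ c₀ (kN1 * t) * T0 M₀ z₀ c₀ + 1 / 10000)

/-- An admissible instance has fit level at least `1/20` when its centre is good at some tolerance (the window's bottom: `¬TightNearCap`). [folklore] -/
theorem fitLevel_ge_of_admissible {η : ℝ} {M₀ : ℕ} {z₀ : Fin M₀ → E3} {c₀ : Fin M₀} (hz : Admissible M₀ z₀ c₀) (hg : GoodAtScale η (3 / 2) z₀ c₀) :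
    1 / 20 ≤ fitLevel z₀ c₀ := by
  refine le_csInf ⟨η, hg⟩ fun η' hη' => ?_
  by_contra hlt
  exact hz.2.2.2.1 ⟨c₀, mem_ball.2 (by rw [dist_self]; norm_num), goodAtScale_mono (not_le.mp hlt).le hη'⟩

/-- `Φ₀ ≤ Φ₁` on chart instances and `t ≥ 0` (all table coefficients are nonnegative, `x ≥ 0`, `T₀ ≥ 0` there). [formal bookkeeping] -/
theorem Phi0_le_Phi1 {M₀ : ℕ} {z₀ : Fin M₀ → E3} {c₀ : Fin M₀} (hI : bentFamily bends0 eta00 M₀ z₀ c₀) {t : ℝ} (ht : 0 ≤ t) :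
    Phi0 M₀ z₀ c₀ t ≤ Phi1 M₀ z₀ c₀ t := by
  have hx : 0 ≤ fitLevel z₀ c₀ - 1 / 20 := by linarith [fitLevel_ge_of_admissible hI.1 hI.2.2]
  have hup : fitLevel z₀ c₀ ≤ 1 / 16 := fitLevel_le_of_goodAtScale (by simpa [eta00] using hI.2.2)
  have hT : 0 ≤ windowRoom z₀ c₀ + 3 / 10 * sigmaOne := by
    have : 0 ≤ windowRoom z₀ c₀ := le_min hx (by linarith)
    linarith [sigmaOne_pos]
  have hs : 0 ≤ kN1 * t := mul_nonneg (by norm_num [kN1]) ht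
  by_cases h : FccGoodAtScale (1 / 8) (3 / 2) z₀ c₀
  · rw [Phi0_fcc h]
    simp only [Phi1, ell1, sw1, ellx1, levelTableShift, if_pos h, T0_eq]
    nlinarith [mul_nonneg hs ht, mul_nonneg hx hs, mul_nonneg hs hs, mul_nonneg (mul_nonneg hs ht) hx, mul_nonneg (mul_nonneg hs ht) hs,
      mul_nonneg hs hT, mul_nonneg (mul_nonneg hx hs) hT, mul_nonneg (mul_nonneg hs hs) hT]
  · rw [Phi0_hcp h]
    simp only [Phi1, ell1, sw1, ellx1, levelTableShift, if_neg h, T0_eq]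
    nlinarith [mul_nonneg hs ht, mul_nonneg hx hs, mul_nonneg hs hs, mul_nonneg (mul_nonneg hs ht) hx, mul_nonneg (mul_nonneg hs ht) hs,
      mul_nonneg hs hT, mul_nonneg (mul_nonneg hx hs) hT, mul_nonneg (mul_nonneg hs hs) hT]

/-- ★ **(F1ʳ-cap-bent₁) LINE A⁺** `:= FamilyEnvelopeRefitCap (bentFamily 𝓑₀ (1/16)) 𝓘₁⁺ (1/4) (1/3) Φ₁ T₀`. -/
def FamilyEnvelopeCapBent1 : Prop := FamilyEnvelopeRefitCap (bentFamily bends0 eta00) CompFamily1 tau0 kN1 Phi1 T0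

/-- ★ **(F3-bent₁) LINE A⁺** `:= FamilyCertRefit (bentFamily 𝓑₀ (1/16)) 𝓘₁⁺ (1/3) 0 Φ₁ T₀` [INSTRUMENTABLE: BUDGET53 = BUDGET52 at (κN₁, Φ₁) plus the pairs whose
comparison instance lies `≤ κN₁T₀ ≤ 1/180` below the window]. -/
def FamilyCertBent1 : Prop := FamilyCertRefit (bentFamily bends0 eta00) CompFamily1 kN1 0 Phi1 T0

/-- THE TRADE A → A⁺ on (F1): (F1ʳ-cap-bent₀) ⟹ (F1ʳ-cap-bent₁) (bigger comparison family, looser level constant, bigger modulus). [formal bookkeeping] -/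
theorem familyEnvelopeCapBent1_of_capBent0 (h : FamilyEnvelopeCapBent0) : FamilyEnvelopeCapBent1 := by
  intro M z c M₀ z₀ c₀ e t hz hcl hm ht htT hch
  obtain ⟨M₁, z₁, c₁, hI₁, hN, h₁⟩ := h M z c M₀ z₀ c₀ e t hz hcl hm ht htT hch
  have hΦ := Phi0_le_Phi1 hch.1 ht
  exact ⟨M₁, z₁, c₁, comparison0_le_compFamily1 M₁ z₁ c₁ hI₁, hN.mono (by norm_num [kN0, kN1]), by linarith⟩

/-- THE TRADE A⁺ → A on (F3): (F3-bent₁) ⟹ (F3-bent₀). [formal bookkeeping] -/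
theorem familyCertBent0_of_certBent1 (h : FamilyCertBent1) : FamilyCertBent0 := by
  intro M₀ z₀ c₀ M₁ z₁ c₁ hI₀ hI₁ hN
  have h₁ := h M₀ z₀ c₀ M₁ z₁ c₁ hI₀ (comparison0_le_compFamily1 M₁ z₁ c₁ hI₁) (hN.mono (by norm_num [kN0, kN1]))
  have hT : 0 ≤ T0 M₀ z₀ c₀ := by
    rw [T0_eq]
    have hx : 0 ≤ fitLevel z₀ c₀ - 1 / 20 := by linarith [fitLevel_ge_of_admissible hI₀.1 hI₀.2.2]
    have hup : fitLevel z₀ c₀ ≤ 1 / 16 := fitLevel_le_of_goodAtScale (by simpa [eta00] using hI₀.2.2)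
    have : 0 ≤ windowRoom z₀ c₀ := le_min hx (by linarith)
    linarith [sigmaOne_pos]
  have hΦ := Phi0_le_Phi1 hI₀ hT
  linarith

/-- ★★ LINE A⁺, EDGE BAND: (F1ʳ-cap-bent₁) ∧ (F2-bent₀) ∧ (F3-bent₁) ⟹ `EdgeFarFloor (63/10) (63/10) (24/5) (1/100) (3/50) 0`. [folklore] -/
theorem edgeFar_capBent1 (hE : FamilyEnvelopeCapBent1) (hR : FamilyRoomBent0) (hC : FamilyCertBent1) :
    EdgeFarFloor (63 / 10) (63 / 10) (24 / 5) (1 / 100) (3 / 50) 0 :=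
  edgeFar_of_familyRefitCap hE hR hC

/-- ★★ LINE A⁺, NODE: (F1ʳ-cap-bent₁) ∧ (F2-bent₀) ∧ (F3-bent₁) ∧ [BRIDGE] `BandFarFloor … (3/50) (1/10) 0` ∧ [SOFT-FAR] `SoftFarFloor … (1/10) 0` ⟹ [CORE-FAR]. [folklore] -/
theorem coreOff_record_capBent1 (hE : FamilyEnvelopeCapBent1) (hR : FamilyRoomBent0) (hC : FamilyCertBent1)
    (hB : BandFarFloor (63 / 10) (63 / 10) (24 / 5) (1 / 100) (3 / 50) (1 / 10) 0) (hS : SoftFarFloor (63 / 10) (63 / 10) (24 / 5) (1 / 100) (1 / 10) 0) :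
    CoreOffTubeFloor (63 / 10) (63 / 10) (24 / 5) (1 / 100) 0 :=
  coreOff_of_familyRefitCap_of_band_of_soft hE hR hC hB hS

/-- Level-1 pin: the fine-deviation amplification of the refit chart `κA₀ = 2` (sup norm of `1 − P` on the uncapped annulus; enters only (BAS) at level 2). -/
noncomputable def kA0 : ℝ := 2
/-- Level-1 pin: the comparison chart's coarse deviation `τ₁ = 7/20` (`≥ τ₀ + |A|·63/10`, `|A| ≤ 0.26·tmax₀`). -/
noncomputable def tau1 : ℝ := 7 / 20
/-- Level-0 pin: the range `tmax₀ = 1/60` (`T₀ ≤ 1/60` on the chart family, `lawLE_T0_bent`). -/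
noncomputable def tmax0 : ℝ := 1 / 60

/-- ★ **(RF-bent₁)** `:= AffineRefit (bentFamily 𝓑₀ (1/16)) 𝓘₁⁺ (1/4) (7/20) (1/3) 2 T₀` [KINEMATIC · `κN₁ = 1/3 ≥` the adversarial least-squares estimate
`|Δlevel| ≤ 0.28·t` — stated test: census KAPPA-N]. -/
def AffineRefitBent1 : Prop := AffineRefit (bentFamily bends0 eta00) CompFamily1 tau0 tau1 kN1 kA0 T0

/-- ★ **(ENV-bent₁ Ψ)** `:= FamilyEnvelopeOn projectedFree 𝓘₁⁺ (7/20) 2 (1/60) Ψ` — the envelope on the comparison family, decomposed at level 2 («EnvelopeTaylor»). -/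
def EnvelopeOnBent1 (Ψ : (M₀ : ℕ) → (Fin M₀ → E3) → Fin M₀ → ℝ → ℝ) : Prop := FamilyEnvelopeOn projectedFree CompFamily1 tau1 kA0 tmax0 Ψ

/-- ★ **(DOM-bent₁ Ψ)** `:= RefitDomination (bentFamily 𝓑₀ (1/16)) 𝓘₁⁺ (1/3) T₀ Ψ Φ₁` [TABLE CERTIFICATE · INSTRUMENTABLE: the level-2 tables read at the
comparison point against `Φ₁` = the pinned tables at the shifted level `x + κN₁t` (so the level slope of `Ψ` is absorbed) — stated test: census BUDGET53/LIN]. -/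
def DominationBent1 (Ψ : (M₀ : ℕ) → (Fin M₀ → E3) → Fin M₀ → ℝ → ℝ) : Prop := RefitDomination (bentFamily bends0 eta00) CompFamily1 kN1 T0 Ψ Phi1

/-- ★★ LEVEL-1 NODE OF RECORD: for ANY level-2 modulus `Ψ`, (RF-bent₁) ∧ (ENV-bent₁ Ψ) ∧ (DOM-bent₁ Ψ) ⟹ (F1ʳ-cap-bent₁); (LAW) is the theorem `lawLE_T0_bent`.
[folklore] -/
theorem familyEnvelopeCapBent1_of_pieces {Ψ : (M₀ : ℕ) → (Fin M₀ → E3) → Fin M₀ → ℝ → ℝ} (hRF : AffineRefitBent1) (hE : EnvelopeOnBent1 Ψ)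
    (hD : DominationBent1 Ψ) : FamilyEnvelopeCapBent1 :=
  familyEnvelopeRefitCap_of_pieces (show LawLE (bentFamily bends0 eta00) T0 tmax0 from lawLE_T0_bent bends0 (by norm_num [eta00])) hRF hE hD

end Summit.AtomisticToContinuum.Crystallization.Theorems.FrustratedLawDichotomyStrainedPatchEnvelopeLaw
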